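import Literature.MathematicalPhysics.QuantumLattice.TIStateMeanEntropy
import Literature.MathematicalPhysics.QuantumLattice.TorusSectorGibbsMixture
import Literature.MathematicalPhysics.QuantumLattice.HubbardTTPrimeDiagHopTransportThermal
import Literature.MathematicalPhysics.QuantumLattice.HubbardTTPrimeEnergyDensityVariationalPrinciple
import Literature.MathematicalPhysics.QuantumLattice.FermionVacuumExtension
import Literature.MathematicalPhysics.QuantumLattice.FermionLocalHamiltonianCovariance
import HarnessLib

/-!
# The LOCAL-MOMENT (Mott) entropy ceiling: `s̄(ω) ≤ log(2 + 2e^κ) − κ·(ρ(ω) − 2D(ω))` for every translation-invariant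
# lattice-fermion state, and the hot-anchor it gives for the canonical `t–t'` Hubbard pressure from two `T = 0` FLOORS:
# `p(β_h; t,s,U; n) ≤ log(2 + 2e^κ) − κ n + 2κ (F − G)/(U − U_l) − β_h F`

Topic `Literature/MathematicalPhysics/QuantumLattice` (family `hubbard`). The `T > 0` competing-order words of the Hubbard
material-oracle programme (`Summits/…/Observables/PhaseSeparationExclusion*Thermal*`) bound the canonical pressure of the DENSE
partner of a phase mixture by the a-priori ceiling `p(0; ·; n) = 2 H_b(n/2)` (`= 2 log 2` at half filling, `pressureTT'_zero…`):
the entropy of four states per site. In the interacting model the charge part of that entropy is frozen: a state whose double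
occupancy `D(ω) = Re ω(n_{0↑} n_{0↓})` is small cannot have one-site entropy much above `log 2`. This file proves the resulting
ceiling with NO thermal input beyond the tree's `T = 0` energy FLOORS:

* §1 ONE SITE. For the one-site region `B₁ = [0,1)^d` the local-moment operator `M = n_↑ + n_↓ − 2 n_↑ n_↓ = (n_↑ − n_↓)²` is
  the diagonal `0/1` matrix of the occupation basis with exactly two entries `1` (`localMoment_eq_diagonal`,
  `univ_orb_halfOpenBox_one`), so `Tr e^{κM} = 2 + 2e^κ` (`partitionFn_neg_localMoment`); its expectation in any infinite-volume state
  is `ρ(ω) − 2 Re ω(n_{0↑}n_{0↓})` (`re_expect_localMoment`).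
* §2 THE ENTROPY CEILING (`IsTranslationInvariant.entropyDensitySup_le_localMoment`): for a translation-invariant `ω` on `ℤ^d`
  (`d ≥ 1`) and every real `κ`, `s̄(ω) ≤ log(2 + 2e^κ) − κ (ρ(ω) − 2 Re ω(n_{0↑}n_{0↓}))` — the mean entropy is at most the
  one-site entropy (`entropyDensitySup_le_boxEntropyDensity`, box subadditivity for even states), which KLEIN's inequality
  (`vonNeumannEntropy_sub_mul_le_log_partitionFn` at `β = 1`) bounds with the witness `−κM`. Optimising `κ` gives the pinched
  maximum entropy `log 2 + H₂(2D)` at half filling (`κ = log((1 − 2D)/(2D))`); the theorem is stated for every `κ` so that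
  consumers choose `e^κ ∈ {2, 3, 4, 5, 9, 15}` and only Mathlib's `log 2 / log 3 / log 5` enclosures enter.
* §3 THE PRESSURE CEILING FROM TWO FLOORS (`ThermodynamicLimit.pressureTT'_le_localMoment_of_floors`, `d = 2`): for
  `0 ≤ U_l < U`, `0 < n < 2`, `β_h > 0`, `κ ≥ 0` with `2κ ≤ β_h (U − U_l)`, and certified floors `F ≤ e(t,s,U,n)`,
  `G ≤ e(t,s,U_l,n)`:  `p(β_h; t,s,U; n) ≤ log(2 + 2e^κ) − κ n + 2κ (F − G)/(U − U_l) − β_h F`. Proof: the canonical pressure is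
  ATTAINED by a translation-invariant torus-limit canonical thermal state `ω` (`exists_isTorusLimitOfMixture_sectorGibbs`,
  `…entropyDensitySup_sub_mul_eq_pressureTT'_of_sectorGibbs`): `p = s̄(ω) − β_h e_U(ω)`; §2 bounds `s̄(ω)`; the `U`-CHORD
  `e_{U_l}(ω) = e_U(ω) − (U − U_l)·D(ω) ≥ e(t,s,U_l,n) ≥ G` (`meanEnergy_hubbardTTPrime_affine`, the variational principle
  `energyDensityTT'_le_meanEnergy`) caps the thermal double occupancy by `(e_U(ω) − G)/(U − U_l)`, and since `2κ/(U − U_l) ≤ β_h`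
  the bound is largest at the smallest admissible energy `e_U(ω) ≥ F`. The monotone form above a column
  (`…pressureTT'_le_localMoment_above_column`) uses `e(t,s,U,n) ≥ e(t,s,U₂,n) ≥ L` for `U ≥ U₂` (`energyDensityTT'_mono_U`).

At half filling with `D ≈ 0.065` (the `U`-chord of the tree's `n = 1` floors at `U = 6 ∣ 8`) the ceiling constant replacing `2 log 2 =
1.386` is `log 20 − 0.87·log 9 = 1.084` (`e^κ = 9`): every `T > 0` competing-order threshold `β₀ = K/M` whose numerator is dominated
by the dense partner drops by `20–45 %` (consumer: `Summits/…/Observables/PhaseSeparationExclusionBoxThermalDoccAnchor.lean`).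
Everything is PROVED; no definition, no named fact, no number of record.

## Mathlib / tree search

REUSED: `IsTranslationInvariant.entropyDensitySup_le_boxEntropyDensity`, `boxEntropyDensity_apply` (`TIStateMeanEntropy`,
`TIVariationalPressure`); `Matrix.IsHermitian.vonNeumannEntropy_sub_mul_le_log_partitionFn` (`GibbsVariationalPrinciple`); `rdm`,
`trace_rdm_mul`, `trace_rdm`, `rdm_posSemidef`, `compatible`, `density`, `densityAt` (`InfVolFermionState`); `nAt_eq_fermionEmbed_incl`
(`FermionVacuumExtension`); `numberAt_orb`, `numberAt_eq_diagonal` (`FermionOperators`); `card_orb_polySite`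
(`FermionLocalHamiltonianCovariance`); `exists_isTorusLimitOfMixture_sectorGibbs` (`HubbardTTPrimeDiagHopTransportThermal`),
`IsTorusLimitOfMixture.isTranslationInvariant`, `…density_eq_of_sectorGibbs`, `…meanEnergy_onSite_eq_re_expect_docc`
(`TorusSectorGibbsMixture`, `TorusLimitOfMixtures`), `…entropyDensitySup_sub_mul_eq_pressureTT'_of_sectorGibbs` (`TIVariationalPressure`),
`meanEnergy_hubbardTTPrime_affine` (`HubbardTTPrimeMeanEnergySupergradient`), `IsTranslationInvariant.energyDensityTT'_le_meanEnergy`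
(`HubbardTTPrimeEnergyDensityVariationalPrinciple`), `energyDensityTT'_mono_U`; Mathlib `Matrix.exp_diagonal`, `Finset.sum_powerset_insert`,
`Finset.powerset_singleton`, `Finset.eq_univ_of_card`. `lean search 'localMoment|entropyDensitySup_le.*docc|pressureTT.*_le_.*floor'`
(2026-08-29): nothing of this kind (the Markov C1 ceilings `MarkovCertificatePressureCeiling` need a cluster certificate node).

## References

* R. B. Israel, *Convexity in the Theory of Lattice Gases* (1979), Lemma II.3.1 (finite-volume Gibbs variational principle / Klein),
  Thm. I.3.4. [cite: Israel1979, Lemma II.3.1]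
* H. Araki, H. Moriya, Rev. Math. Phys. 15 (2003) 93–198, Theorem 3.8 and §10 (SSA and mean entropy of even states of the Fermion
  algebra). [cite: ArakiMoriya2003, Theorem 3.8 and §10]
* E. H. Lieb, Commun. Math. Phys. 31 (1973) 327, §V (5.2)–(5.4) (`∂e/∂U = D`, concavity in `U`: the `U`-chord). [cite: Lieb1973, §V (5.2)–(5.4)]
* D. Poulin, M. B. Hastings, Phys. Rev. Lett. 106 (2011) 080403, eqs. (3)–(8) (entropy/Markov upper bounds on the free energy).
  [cite: PoulinHastings2011, eqs. (3)–(8)]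
-/

noncomputable section

open scoped ComplexOrder BigOperators
open Finset Matrix Literature.InformationTheory.Entropy

namespace Literature.MathematicalPhysics.QuantumLattice

open HubbardWave0 Literature.Probability.LatticeModels ThermodynamicLimit
open _root_.Filter
open scoped _root_.Topology

/-! ### §1 The one-site local-moment operator: diagonal form, partition function, expectation -/

namespace InfVolFermionState

variable {d : ℕ}

/-- `0 ∈ [0,1)^d`. [cite: FriedliVelenikSMLS2017, §3.2] -/
theorem zero_mem_halfOpenBox_one : (0 : Site d) ∈ halfOpenBox d 1 := by
  rw [mem_halfOpenBox]; intro i; simp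

/-- `{0} ⊆ [0,1)^d`. [cite: FriedliVelenikSMLS2017, §3.2] -/
theorem singleton_zero_subset_halfOpenBox_one : ({0} : Finset (Site d)) ⊆ halfOpenBox d 1 :=
  Finset.singleton_subset_iff.2 zero_mem_halfOpenBox_one

/-- The two orbitals `(0,↑) ≠ (0,↓)` of the one-site region. [cite: ArakiMoriya2003, §4.1] -/
theorem orb_pt_zero_ne {Λ : Finset (Site d)} (h0 : (0 : Site d) ∈ Λ) :
    orb (PolySite.pt 0 h0) (0 : Fin 2) ≠ orb (PolySite.pt 0 h0) 1 := by
  intro h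
  have := congrArg (fun o : Orb (PolySite Λ) => (ofLex o).2) h
  simp at this

/-- **The orbitals of the one-site region `[0,1)^d` are exactly `(0,↑), (0,↓)`.** [cite: ArakiMoriya2003, §4.1] -/
theorem univ_orb_halfOpenBox_one :
    (Finset.univ : Finset (Orb (PolySite (halfOpenBox d 1)))) =
      {orb (PolySite.pt 0 zero_mem_halfOpenBox_one) 0, orb (PolySite.pt 0 zero_mem_halfOpenBox_one) 1} := by
  symm
  apply Finset.eq_univ_of_card
  rw [Finset.card_pair (orb_pt_zero_ne _), card_orb_polySite, card_halfOpenBox, one_pow, one_mul]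

/-- **The local moment `(n_↑ − n_↓)² = n_↑ + n_↓ − 2 n_↑ n_↓` is diagonal in the occupation basis** with entry
`[↑ ∈ s] + [↓ ∈ s] − 2[↑ ∈ s][↓ ∈ s] ∈ {0, 1}`. [cite: Lieb1995, §2] -/
theorem localMoment_eq_diagonal {Λ : Finset (Site d)} (x : Site d) (hx : x ∈ Λ) :
    (nAt x hx 0 + nAt x hx 1 - 2 • (nAt x hx 0 * nAt x hx 1) : FermionOp Λ) =
      diagonal fun s => (((if orb (PolySite.pt x hx) (0 : Fin 2) ∈ s then (1 : ℝ) else 0) +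
        (if orb (PolySite.pt x hx) (1 : Fin 2) ∈ s then (1 : ℝ) else 0) -
        2 * ((if orb (PolySite.pt x hx) (0 : Fin 2) ∈ s then (1 : ℝ) else 0) *
          (if orb (PolySite.pt x hx) (1 : Fin 2) ∈ s then (1 : ℝ) else 0)) : ℝ) : ℂ) := by
  rw [nAt, nAt, ← numberAt_orb, ← numberAt_orb, numberAt_eq_diagonal, numberAt_eq_diagonal, diagonal_mul_diagonal,
    diagonal_add, ← diagonal_smul, diagonal_sub]
  congr 1
  funext s
  simp only [Pi.smul_apply, nsmul_eq_mul, Nat.cast_ofNat]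
  push_cast
  split_ifs <;> norm_num

/-- The local-moment witness `−κ (n_↑ − n_↓)²` is Hermitian. [cite: Lieb1995, §2] -/
theorem isHermitian_neg_smul_localMoment {Λ : Finset (Site d)} (x : Site d) (hx : x ∈ Λ) (κ : ℝ) :
    (-((κ : ℝ) : ℂ) • (nAt x hx 0 + nAt x hx 1 - 2 • (nAt x hx 0 * nAt x hx 1)) : FermionOp Λ).IsHermitian := by
  rw [localMoment_eq_diagonal, ← diagonal_smul]
  refine Matrix.isHermitian_diagonal_iff.2 fun s => ?_
  rw [Pi.smul_apply, smul_eq_mul, ← Complex.ofReal_neg, ← Complex.ofReal_mul]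
  exact Complex.conj_ofReal _

/-- **`Tr_{one site} e^{κ (n_↑ − n_↓)²} = 2 + 2 e^κ`** (the empty and the doubly occupied configuration carry moment `0`, the two
singly occupied ones moment `1`). [cite: Israel1979, Lemma II.3.1] -/
theorem partitionFn_neg_localMoment (κ : ℝ) :
    partitionFn 1 (-((κ : ℝ) : ℂ) • (nAt (0 : Site d) zero_mem_halfOpenBox_one 0 + nAt 0 zero_mem_halfOpenBox_one 1 -
        2 • (nAt 0 zero_mem_halfOpenBox_one 0 * nAt 0 zero_mem_halfOpenBox_one 1)) :
          FermionOp (halfOpenBox d 1)) = ((2 + 2 * Real.exp κ : ℝ) : ℂ) := by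
  have hne := orb_pt_zero_ne (zero_mem_halfOpenBox_one (d := d))
  have huniv : (Finset.univ : Finset (Finset (Orb (PolySite (halfOpenBox d 1))))) =
      ({orb (PolySite.pt 0 zero_mem_halfOpenBox_one) 0, orb (PolySite.pt 0 zero_mem_halfOpenBox_one) 1} :
        Finset (Orb (PolySite (halfOpenBox d 1)))).powerset := by
    rw [← univ_orb_halfOpenBox_one, Finset.powerset_univ]
  have hp : ({orb (PolySite.pt (0 : Site d) zero_mem_halfOpenBox_one) (1 : Fin 2)} :
      Finset (Orb (PolySite (halfOpenBox d 1)))).powerset = {∅, {orb (PolySite.pt (0 : Site d) zero_mem_halfOpenBox_one) 1}} := by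
    ext u
    rw [Finset.mem_powerset, Finset.subset_singleton_iff, Finset.mem_insert, Finset.mem_singleton]
  rw [localMoment_eq_diagonal, partitionFn, gibbsWeight, ← diagonal_smul, ← diagonal_smul, Matrix.exp_diagonal,
    trace_diagonal, huniv, Finset.sum_powerset_insert (by rwa [Finset.mem_singleton]), hp,
    Finset.sum_pair (Finset.empty_ne_singleton _), Finset.sum_pair (Finset.empty_ne_singleton _)]
  simp only [Pi.exp_def, Pi.smul_apply, smul_eq_mul, Finset.notMem_empty, Finset.mem_singleton, Finset.mem_insert,
    hne, hne.symm, if_false, if_true, or_true, or_false]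
  norm_num [← Complex.exp_eq_exp_ℂ]
  rw [← Complex.ofReal_exp]
  push_cast
  ring

/-- **`Re ω_{[0,1)^d}((n_↑ − n_↓)²) = ρ(ω) − 2 Re ω(n_{0↑} n_{0↓})`** for every infinite-volume state (isotony `{0} ⊆ [0,1)^d`).
[cite: ArakiMoriya2003, §4.1 Def. 4.5] -/
theorem re_expect_localMoment (ω : InfVolFermionState d) :
    (ω.expect (halfOpenBox d 1) (nAt (0 : Site d) zero_mem_halfOpenBox_one 0 + nAt 0 zero_mem_halfOpenBox_one 1 -
        2 • (nAt 0 zero_mem_halfOpenBox_one 0 * nAt 0 zero_mem_halfOpenBox_one 1))).re =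
      ω.density - 2 * (ω.expect ({0} : Finset (Site d))
        (nAt 0 (Finset.mem_singleton_self 0) 0 * nAt 0 (Finset.mem_singleton_self 0) 1)).re := by
  have hS := (singleton_zero_subset_halfOpenBox_one (d := d))
  have e0 : (nAt (0 : Site d) zero_mem_halfOpenBox_one 0 : FermionOp (halfOpenBox d 1)) =
      fermionEmbed (PolySite.incl hS) (nAt 0 (Finset.mem_singleton_self 0) 0) :=
    nAt_eq_fermionEmbed_incl hS (Finset.mem_singleton_self 0) 0
  have e1 : (nAt (0 : Site d) zero_mem_halfOpenBox_one 1 : FermionOp (halfOpenBox d 1)) =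
      fermionEmbed (PolySite.incl hS) (nAt 0 (Finset.mem_singleton_self 0) 1) :=
    nAt_eq_fermionEmbed_incl hS (Finset.mem_singleton_self 0) 1
  rw [e0, e1, ← map_mul, ← map_add, ← map_nsmul, ← map_sub, ω.compatible hS, map_sub, map_nsmul, Complex.sub_re,
    InfVolFermionState.density, InfVolFermionState.densityAt, nsmul_eq_mul, Nat.cast_ofNat]
  simp [Complex.mul_re]

/-! ### §2 The local-moment entropy ceiling for translation-invariant states -/

/-- **THE LOCAL-MOMENT (Mott) ENTROPY CEILING.** For a translation-invariant state `ω` of the lattice-fermion system on `ℤ^d`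
(`d ≥ 1`) and every real `κ`: `s̄(ω) ≤ log(2 + 2e^κ) − κ·(ρ(ω) − 2 Re ω(n_{0↑}n_{0↓}))` — mean entropy ≤ one-site entropy (box
subadditivity), Klein's inequality on the one-site algebra with the witness `−κ(n_↑ − n_↓)²`, `Tr e^{κ(n_↑−n_↓)²} = 2 + 2e^κ`.
[cite: ArakiMoriya2003, Theorem 3.8 and §10] [cite: Israel1979, Lemma II.3.1] -/
theorem IsTranslationInvariant.entropyDensitySup_le_localMoment (hd : 0 < d) {ω : InfVolFermionState d}
    (hω : ω.IsTranslationInvariant) (κ : ℝ) :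
    ω.entropyDensitySup ≤ Real.log (2 + 2 * Real.exp κ) -
      κ * (ω.density - 2 * (ω.expect ({0} : Finset (Site d))
        (nAt 0 (Finset.mem_singleton_self 0) 0 * nAt 0 (Finset.mem_singleton_self 0) 1)).re) := by
  have h1 := hω.entropyDensitySup_le_boxEntropyDensity hd (m := 1) le_rfl
  rw [boxEntropyDensity_apply, Nat.cast_one, one_pow, div_one] at h1
  have hK := (isHermitian_neg_smul_localMoment (0 : Site d) zero_mem_halfOpenBox_one κ).vonNeumannEntropy_sub_mul_le_log_partitionFn
    1 (ω.rdm_posSemidef (halfOpenBox d 1)) (ω.trace_rdm _)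
  rw [partitionFn_neg_localMoment, Complex.ofReal_re, one_mul, trace_rdm_mul, map_smul, smul_eq_mul, ← Complex.ofReal_neg,
    Complex.re_ofReal_mul, re_expect_localMoment] at hK
  linarith

/-- The same ceiling with the double occupancy written as the on-site mean energy `D(ω) = e_{Φ(0,0,1)}(ω)` of a torus-limit state
(`d = 2`). [cite: ArakiMoriya2003, Theorem 3.8 and §10] [cite: Israel1979, Lemma II.3.1] -/
theorem IsTorusLimitOfMixture.entropyDensitySup_le_localMoment {ω : InfVolFermionState 2} {m : ℕ → ℕ}
    {p : ∀ L, Fin (m L) → ℝ} {ψ : ∀ L, Fin (m L) → Fock (Orb (FermionTorus 2 L))} {Ls : ℕ → ℕ}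
    (h : ω.IsTorusLimitOfMixture m p ψ Ls) (hLs : Tendsto Ls atTop atTop) (hω : ω.IsTranslationInvariant) (κ : ℝ) :
    ω.entropyDensitySup ≤ Real.log (2 + 2 * Real.exp κ) -
      κ * (ω.density - 2 * ω.meanEnergy (hubbardTTPrimeFermionInteraction 0 0 1) 1) := by
  rw [h.meanEnergy_onSite_eq_re_expect_docc hLs]
  exact hω.entropyDensitySup_le_localMoment two_pos κ

end InfVolFermionState

/-! ### §3 The hot anchor of the canonical `t–t'` Hubbard pressure from two `T = 0` floors -/

namespace ThermodynamicLimit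

open InfVolFermionState

/-- **HOT PRESSURE CEILING FROM TWO FLOORS (local-moment witness + `U`-chord).** `0 ≤ U_l < U`, `0 < n < 2`, `β_h > 0`, `κ ≥ 0`
with `2κ ≤ β_h·(U − U_l)`, and floors `F ≤ e(t,s,U,n)`, `G ≤ e(t,s,U_l,n)`:
`p(β_h; t,s,U; n) ≤ log(2 + 2e^κ) − κ·n + 2κ·(F − G)/(U − U_l) − β_h·F`. The pressure is attained by a translation-invariant
canonical thermal torus-limit state `ω`: `p = s̄(ω) − β_h e_U(ω)`; `s̄(ω) ≤ log(2+2e^κ) − κ(n − 2D(ω))` (§2); the `U`-chord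
`(U − U_l)·D(ω) = e_U(ω) − e_{U_l}(ω) ≤ e_U(ω) − G` caps the thermal double occupancy; and `2κ/(U − U_l) ≤ β_h` makes the bound
largest at `e_U(ω) = F`. NO thermal certificate enters. [cite: Israel1979, Lemma II.3.1] [cite: Lieb1973, §V (5.2)–(5.4)]
[cite: PoulinHastings2011, eqs. (3)–(8)] -/
theorem pressureTT'_le_localMoment_of_floors (t s : ℝ) {U Ul n βh κ F G : ℝ} (hUl : 0 ≤ Ul) (hUlU : Ul < U)
    (hn0 : 0 < n) (hn2 : n < 2) (hβh : 0 < βh) (hκ : 0 ≤ κ) (hκβ : 2 * κ ≤ βh * (U - Ul))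
    (hF : F ≤ energyDensityTT' t s U n) (hG : G ≤ energyDensityTT' t s Ul n) :
    pressureTT' βh t s U n ≤ Real.log (2 + 2 * Real.exp κ) - κ * n + 2 * κ * (F - G) / (U - Ul) - βh * F := by
  have hU : 0 ≤ U := hUl.trans hUlU.le
  have hΔ : 0 < U - Ul := sub_pos.2 hUlU
  obtain ⟨φ, hφ, ω, hω⟩ := exists_isTorusLimitOfMixture_sectorGibbs βh t s U hn0.le hn2.le (Ls := fun k => k) tendsto_id
  have hLs : Tendsto ((fun k : ℕ => k) ∘ φ) atTop atTop := hφ.tendsto_atTop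
  have hTI := hω.isTranslationInvariant
  have hρ := hω.density_eq_of_sectorGibbs t s U hn0.le hn2.le βh hLs
  have heq := hω.entropyDensitySup_sub_mul_eq_pressureTT'_of_sectorGibbs t s hU hβh hn0 hn2 hLs
  -- the entropy ceiling
  have hS := hω.entropyDensitySup_le_localMoment hLs hTI κ
  rw [hρ] at hS
  -- the two floors at the state
  set e := ω.meanEnergy (hubbardTTPrimeFermionInteraction t s U) 1 with he
  set D := ω.meanEnergy (hubbardTTPrimeFermionInteraction 0 0 1) 1 with hD
  have hρ0 : 0 < ω.density := by rw [hρ]; exact hn0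
  have hρ2 : ω.density < 2 := by rw [hρ]; exact hn2
  have hFe : F ≤ e := by
    have h := hTI.energyDensityTT'_le_meanEnergy t s hU hρ0 hρ2
    rw [hρ] at h
    exact hF.trans h
  have hGe : G ≤ e + (Ul - U) * D := by
    have h := hTI.energyDensityTT'_le_meanEnergy t s hUl hρ0 hρ2
    rw [hρ, ω.meanEnergy_hubbardTTPrime_affine t s U s Ul, sub_self, zero_mul, add_zero] at h
    exact hG.trans h
  -- chord: (U - Ul) D ≤ e - G
  have hchord : (U - Ul) * D ≤ e - G := by linarith
  have h1 : 2 * κ * ((U - Ul) * D) ≤ 2 * κ * (e - G) := mul_le_mul_of_nonneg_left hchord (by linarith)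
  have h2 : 0 ≤ (βh * (U - Ul) - 2 * κ) * (e - F) := mul_nonneg (by linarith) (by linarith)
  have key : (2 * κ * D - βh * e) * (U - Ul) ≤ 2 * κ * (F - G) - βh * F * (U - Ul) := by
    have e1 : (2 * κ * D - βh * e) * (U - Ul) = 2 * κ * ((U - Ul) * D) - βh * e * (U - Ul) := by ring
    have e2 : (βh * (U - Ul) - 2 * κ) * (e - F) = βh * e * (U - Ul) - βh * F * (U - Ul) - 2 * κ * (e - G) + 2 * κ * (F - G) := by
      ring
    rw [e1]
    rw [e2] at h2
    linarith
  have key' : 2 * κ * D - βh * e ≤ 2 * κ * (F - G) / (U - Ul) - βh * F := by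
    rw [le_sub_iff_add_le]
    have h3 : (2 * κ * D - βh * e + βh * F) * (U - Ul) ≤ 2 * κ * (F - G) := by
      have e3 : (2 * κ * D - βh * e + βh * F) * (U - Ul) = (2 * κ * D - βh * e) * (U - Ul) + βh * F * (U - Ul) := by ring
      rw [e3]
      linarith
    exact (le_div_iff₀ hΔ).2 h3
  have hS' : ω.entropyDensitySup ≤ Real.log (2 + 2 * Real.exp κ) - κ * n + 2 * κ * D := by
    have e4 : Real.log (2 + 2 * Real.exp κ) - κ * (n - 2 * D) = Real.log (2 + 2 * Real.exp κ) - κ * n + 2 * κ * D := by ring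
    rw [← e4]; exact hS
  rw [← heq]
  linarith

/-- **ABOVE A COLUMN**: if `L ≤ e(t,s,U₂,n)` (`U_l < U₂`, so `L` floors every `U ≥ U₂` by monotonicity in `U`), `G ≤ e(t,s,U_l,n)`,
`G ≤ L`, `κ ≥ 0`, `2κ ≤ β_h (U₂ − U_l)`: for every `U ≥ U₂`,
`p(β_h; t,s,U; n) ≤ log(2 + 2e^κ) − κ n + 2κ (L − G)/(U₂ − U_l) − β_h L` (the chord slope only decreases with `U`).
[cite: Lieb1973, §V (5.2)–(5.4)] [cite: Israel1979, Lemma II.3.1] -/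
theorem pressureTT'_le_localMoment_above_column (t s : ℝ) {U U₂ Ul n βh κ L G : ℝ} (hUl : 0 ≤ Ul) (hUl₂ : Ul < U₂)
    (hU : U₂ ≤ U) (hn0 : 0 < n) (hn2 : n < 2) (hβh : 0 < βh) (hκ : 0 ≤ κ) (hκβ : 2 * κ ≤ βh * (U₂ - Ul))
    (hL : L ≤ energyDensityTT' t s U₂ n) (hG : G ≤ energyDensityTT' t s Ul n) (hGL : G ≤ L) :
    pressureTT' βh t s U n ≤ Real.log (2 + 2 * Real.exp κ) - κ * n + 2 * κ * (L - G) / (U₂ - Ul) - βh * L := by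
  have hΔ₂ : 0 < U₂ - Ul := sub_pos.2 hUl₂
  have hΔ : 0 < U - Ul := by linarith
  have hLU : L ≤ energyDensityTT' t s U n :=
    hL.trans (energyDensityTT'_mono_U t s hn0.le hn2 (hUl.trans hUl₂.le) hU)
  have hκβ' : 2 * κ ≤ βh * (U - Ul) := hκβ.trans (mul_le_mul_of_nonneg_left (by linarith) hβh.le)
  have h := pressureTT'_le_localMoment_of_floors t s hUl (hUl₂.trans_le hU) hn0 hn2 hβh hκ hκβ' hLU hG
  have hmono : 2 * κ * (L - G) / (U - Ul) ≤ 2 * κ * (L - G) / (U₂ - Ul) :=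
    div_le_div_of_nonneg_left (mul_nonneg (by linarith) (sub_nonneg.2 hGL)) hΔ₂ (by linarith)
  linarith

end ThermodynamicLimit

end Literature.MathematicalPhysics.QuantumLattice

end
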